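import Literature.Computability.Cryptography.KitaevPhaseEstimationCircuit
import Literature.Computability.QuantumComplexity.CoinFamilyKernel
import HarnessLib

/-!
# Period finding by eigenvalue estimation of shifts, II: the sandwich circuit relative to an oracle

Family `PQC` / quantum-advantage barrier `PPolyOracles`; second file towards the discharge of
`Literature.Barriers.QuantumAdvantage.aaronsonChen2017_lem75_quantum` (Aaronson–Chen 2017,
Lemma 7.5 (2)–(3), App. 13: Boneh–Lipton period finding). Kitaev's eigenvalue-measurement
circuit of `KitaevPhaseEstimationCircuit.lean` (Hadamard tests in parallel around a clean
classical block, oracle-free, run relative to the empty oracle) is generalised in the two ways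
the period-finding experiment needs:

* the coin register is split into `k₁` CONTROL wires `y` (Hadamard before and after the block,
  `S³` on the sine-test controls) and `k₂` OFFSET wires `Z` (Hadamard BEFORE the block only:
  a uniformly random offset that is read out but not interfered), layout `tri x (Fin.append y Z) ρ`
  (`yOf`, `zOf`, `appendEquiv`, `yWire`, `yWires`);
* the classical block `V` may contain ORACLE GATES, and everything is stated relative to an
  arbitrary oracle language `A` (the block acts as `|x (y Z) 0^m⟩ ↦ |x (y Z) (R y Z)⟩` relative
  to `A`; the Hadamard and phase layers are oracle-free, `toMatrix_hLayer`, `toMatrix_phaseLayer`).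

Results: `sandwich V σ` (the circuit `H_{y,Z}; V; S³_σ; H_y`), `hLayerY_mulVec_tri` (the final
Hadamard layer on the control wires only), **`sandwich_runOn`** and **`sandwich_runOn_tri`**
(output state and amplitudes: `ψ(x (γ Z) ρ) = 2^{-(k₁+k₂)/2} 2^{-k₁/2} ∑_{y : R y Z = ρ}
(-i)^{#σ∧y} (-1)^{y·γ}`), `sandwich_runOn_of_ne`, and **`sandwich_prob_yEvent`**: the Born
probability that the control read-out lies in `E` is
`2^{-(k₁+k₂)} 2^{-k₁} ∑_{γ ∈ E} ∑_Z ∑_ρ |∑_{y : R y Z = ρ} (-i)^{#σ∧y} (-1)^{y·γ}|²` — the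
left-hand side of the autocorrelation Parseval identity `PeriodFinding.parseval_shift`
(`PeriodFindingSums.lean`) once `R y Z` reads shifted table values.

## References

* A. Yu. Kitaev, *Quantum measurements and the Abelian Stabilizer Problem*,
  arXiv:quant-ph/9511026 (1995), §3 (Remark 8, Lemma 8, Lemma 10) [Kitaev1995].
* P. W. Shor, SIAM J. Comput. 26 (1997) 1484–1509, §5 [Shor1997].
* E. Bernstein, U. Vazirani, SIAM J. Comput. 26 (1997), §8.3 (oracle gates on basis states)
  [BernsteinVazirani1997].
* M. A. Nielsen, I. L. Chuang, *Quantum Computation and Quantum Information*, CUP 2010, §1.4.4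
  eq. (1.50), §2.2.5 [NielsenChuang2010].

## Tree

`tri`, `coinInput_eq_tri`, `tri_eq_tri_iff`, `hadamardLayer_mulVec_padInput` (`BQPProofs`),
`hadamardLayer_toMatrix` (`CoinFamilyKernel`),
`hadamards_mulVec_basisState_signed`, `hSign`, `ySign`, `sPhase`, `phaseLayer`,
`phaseLayer_mulVec_tri`, `phaseLayerL_isOracleFree` (`KitaevPhaseEstimationCircuit`),
`QCircuit.toMatrix_eq_of_isOracleFree`, `norm_invSqrt2_pow_sq`.
-/

noncomputable section

namespace Literature.Computability.Cryptography

namespace PeriodFinding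

open _root_.Computability Complexity QuantumComplexity Matrix Finset Kitaev1995

/-! ### Splitting the coin register: controls `y` and offsets `Z` -/

section split

variable {k₁ k₂ : ℕ}

/-- The control part (first `k₁` coins) of a coin string. [folklore] -/
def yOf (c : QReg (k₁ + k₂)) : QReg k₁ := fun j => c (Fin.castAdd k₂ j)

/-- The offset part (last `k₂` coins) of a coin string. [folklore] -/
def zOf (c : QReg (k₁ + k₂)) : QReg k₂ := fun j => c (Fin.natAdd k₁ j)

/-- Control part of `y Z`. [folklore] -/
@[simp] theorem yOf_append (y : QReg k₁) (Z : QReg k₂) : yOf (Fin.append y Z) = y :=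
  funext fun j => by simp [yOf]

/-- Offset part of `y Z`. [folklore] -/
@[simp] theorem zOf_append (y : QReg k₁) (Z : QReg k₂) : zOf (Fin.append y Z) = Z :=
  funext fun j => by simp [zOf]

/-- A coin string is its control part followed by its offset part. [folklore] -/
theorem append_yOf_zOf (c : QReg (k₁ + k₂)) : Fin.append (yOf c) (zOf c) = c := by
  funext i
  induction i using Fin.addCases with
  | left j => simp [yOf]
  | right j => simp [zOf]

/-- `Fin.append` is injective in the pair. [folklore] -/
theorem append_eq_append_iff {y y' : QReg k₁} {Z Z' : QReg k₂} :
    Fin.append y Z = Fin.append y' Z' ↔ y = y' ∧ Z = Z' := by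
  constructor
  · intro h
    exact ⟨by rw [← yOf_append y Z, h, yOf_append], by rw [← zOf_append y Z, h, zOf_append]⟩
  · rintro ⟨rfl, rfl⟩
    rfl

variable (k₁ k₂) in
/-- Coin strings are pairs (control part, offset part). [folklore] -/
def appendEquiv : QReg k₁ × QReg k₂ ≃ QReg (k₁ + k₂) where
  toFun p := Fin.append p.1 p.2
  invFun c := (yOf c, zOf c)
  left_inv p := by
    obtain ⟨y, Z⟩ := p
    simp
  right_inv c := append_yOf_zOf c

end split

/-! ### The control wires inside the register `x (y Z) ρ` -/

section wires

variable (n k₁ k₂ m : ℕ)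

/-- The wire of control `j`: coin wire `castAdd k₂ j` of the layout `x c ρ`, `c = y Z`. [folklore] -/
def yWire (j : Fin k₁) : Fin (n + ((k₁ + k₂) + m)) := coinWire n (k₁ + k₂) m (Fin.castAdd k₂ j)

/-- The wire of offset bit `j`: coin wire `natAdd k₁ j`. [folklore] -/
def zWire (j : Fin k₂) : Fin (n + ((k₁ + k₂) + m)) := coinWire n (k₁ + k₂) m (Fin.natAdd k₁ j)

/-- The list of the control wires. [folklore] -/
def yWires : List (Fin (n + ((k₁ + k₂) + m))) := (List.finRange k₁).map (yWire n k₁ k₂ m)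

variable {n k₁ k₂ m}

/-- Distinct controls sit on distinct wires. [folklore] -/
theorem yWire_injective : Function.Injective (yWire n k₁ k₂ m) := fun a b h => by
  have := coinWire_injective _ _ _ h
  exact Fin.castAdd_injective _ _ this

/-- The list of control wires has no duplicates. [folklore] -/
theorem yWires_nodup : (yWires n k₁ k₂ m).Nodup :=
  (List.nodup_finRange k₁).map yWire_injective

/-- There are `k₁` control wires. [folklore] -/
@[simp] theorem length_yWires : (yWires n k₁ k₂ m).length = k₁ := by simp [yWires]

/-- Membership in the list of control wires. [folklore] -/
theorem mem_yWires_iff (i : Fin (n + ((k₁ + k₂) + m))) :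
    i ∈ yWires n k₁ k₂ m ↔ ∃ j, yWire n k₁ k₂ m j = i := by
  simp [yWires]

/-- Offset wires are not control wires. [folklore] -/
theorem zWire_not_mem_yWires (j : Fin k₂) : zWire n k₁ k₂ m j ∉ yWires n k₁ k₂ m := by
  rw [mem_yWires_iff]
  rintro ⟨j', h⟩
  have h' := congrArg Fin.val (coinWire_injective _ _ _ h)
  simp at h'
  omega

/-- Input wires are not control wires. [folklore] -/
theorem castAdd_not_mem_yWires (i : Fin n) : Fin.castAdd ((k₁ + k₂) + m) i ∉ yWires n k₁ k₂ m := by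
  rw [mem_yWires_iff]
  rintro ⟨j, h⟩
  exact castAdd_not_mem_coinWires (k := k₁ + k₂) (m := m) i
    ((mem_coinWires_iff _).2 ⟨_, h⟩)

/-- Work wires are not control wires. [folklore] -/
theorem work_not_mem_yWires (l : Fin m) :
    Fin.natAdd n (Fin.natAdd (k₁ + k₂) l) ∉ yWires n k₁ k₂ m := by
  rw [mem_yWires_iff]
  rintro ⟨j, h⟩
  exact work_not_mem_coinWires (k := k₁ + k₂) (n := n) l ((mem_coinWires_iff _).2 ⟨_, h⟩)

/-- Control wires of `x (y Z) ρ` hold `y`. [folklore] -/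
@[simp] theorem tri_yWire (x : QReg n) (y : QReg k₁) (Z : QReg k₂) (ρ : QReg m) (j : Fin k₁) :
    tri x (Fin.append y Z) ρ (yWire n k₁ k₂ m j) = y j := by
  simp [yWire]

/-- Offset wires of `x (y Z) ρ` hold `Z`. [folklore] -/
@[simp] theorem tri_zWire (x : QReg n) (y : QReg k₁) (Z : QReg k₂) (ρ : QReg m) (j : Fin k₂) :
    tri x (Fin.append y Z) ρ (zWire n k₁ k₂ m j) = Z j := by
  simp [zWire]

/-- **The labels agreeing with `x (y Z) ρ` off the control wires are the `x (γ Z) ρ`.** [folklore] -/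
theorem eq_tri_append_iff (x : QReg n) (y : QReg k₁) (Z : QReg k₂) (ρ : QReg m)
    (z : QReg (n + ((k₁ + k₂) + m))) (γ : QReg k₁) :
    z = tri x (Fin.append γ Z) ρ ↔
      (∀ i, i ∉ yWires n k₁ k₂ m → z i = tri x (Fin.append y Z) ρ i) ∧
        (fun j => z (yWire n k₁ k₂ m j)) = γ := by
  constructor
  · rintro rfl
    refine ⟨fun i hi => ?_, funext fun j => by simp⟩
    induction i using Fin.addCases with
    | left i => simp
    | right i =>
      induction i using Fin.addCases with
      | left c =>
        induction c using Fin.addCases with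
        | left j => exact absurd ((mem_yWires_iff _).2 ⟨j, rfl⟩) hi
        | right j => exact (tri_zWire x γ Z ρ j).trans (tri_zWire x y Z ρ j).symm
      | right l => simp
  · rintro ⟨h1, rfl⟩
    funext i
    induction i using Fin.addCases with
    | left i => rw [h1 _ (castAdd_not_mem_yWires i)]; simp
    | right i =>
      induction i using Fin.addCases with
      | left c =>
        induction c using Fin.addCases with
        | left j =>
          show z (yWire n k₁ k₂ m j) =
            tri x (Fin.append (fun j => z (yWire n k₁ k₂ m j)) Z) ρ (yWire n k₁ k₂ m j)
          rw [tri_yWire]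
        | right j =>
          show z (zWire n k₁ k₂ m j) =
            tri x (Fin.append (fun j => z (yWire n k₁ k₂ m j)) Z) ρ (zWire n k₁ k₂ m j)
          rw [h1 _ (zWire_not_mem_yWires j), tri_zWire, tri_zWire]
      | right l => rw [h1 _ (work_not_mem_yWires l)]; simp

/-- `hSign` over the control wires of `x (y Z) ρ` against `z` is `(-1)^{y · z|_controls}`. [folklore] -/
theorem hSign_yWires (x : QReg n) (y : QReg k₁) (Z : QReg k₂) (ρ : QReg m)
    (z : QReg (n + ((k₁ + k₂) + m))) :
    hSign (yWires n k₁ k₂ m) (tri x (Fin.append y Z) ρ) z =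
      ySign y (fun j => z (yWire n k₁ k₂ m j)) := by
  rw [hSign, ySign, yWires, List.map_map, ← List.ofFn_eq_map, List.prod_ofFn]
  refine prod_congr rfl fun j _ => ?_
  simp

end wires

/-! ### The layers relative to an oracle -/

section layers

variable {N : ℕ}

/-- A layer of Hadamard gates is oracle-free: its matrix does not depend on the oracle. [folklore] -/
theorem toMatrix_hLayer (A : Language Bool) (ws : List (Fin N)) :
    (⟨ws.map hOn⟩ : QCircuit cliffordT N).toMatrix A = (⟨ws.map hOn⟩ : QCircuit cliffordT N).toMatrix 0 :=
  QCircuit.toMatrix_eq_of_isOracleFree (fun g hg => by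
    obtain ⟨i, -, rfl⟩ := List.mem_map.1 hg
    exact hOn_isOracleFree i) A 0

variable {n k m : ℕ}

/-- The phase layer relative to an oracle (for the coin layer: `hadamardLayer_toMatrix`,
`CoinFamilyKernel.lean`). [folklore] -/
theorem toMatrix_phaseLayer (A : Language Bool) (σ : Fin k → Bool) :
    (⟨phaseLayer n k m σ⟩ : QCircuit cliffordT (n + (k + m))).toMatrix A =
      (⟨phaseLayer n k m σ⟩ : QCircuit cliffordT (n + (k + m))).toMatrix 0 :=
  QCircuit.toMatrix_eq_of_isOracleFree (phaseLayerL_isOracleFree _ _) A 0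

end layers

/-! ### The sandwich circuit -/

section sandwich

variable {n k₁ k₂ m : ℕ}

/-- The sine-test flags extended by `false` on the offset coins. [folklore] -/
def extσ (σ : Fin k₁ → Bool) : Fin (k₁ + k₂) → Bool := Fin.append σ fun _ => false

/-- The phase of `y Z` under the extended flags is the phase of `y`. [folklore] -/
theorem sPhase_extσ (σ : Fin k₁ → Bool) (y : QReg k₁) (Z : QReg k₂) :
    sPhase (extσ (k₂ := k₂) σ) (Fin.append y Z) = sPhase σ y := by
  rw [sPhase, sPhase, Fin.prod_univ_add]
  have h2 : ∏ j : Fin k₂, (if extσ (k₂ := k₂) σ (Fin.natAdd k₁ j) && Fin.append y Z (Fin.natAdd k₁ j)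
      then -Complex.I else 1) = 1 :=
    prod_eq_one fun j _ => by simp [extσ]
  rw [h2, mul_one]
  refine prod_congr rfl fun j _ => ?_
  simp [extσ]

/-- **The shift-experiment circuit** ("sandwich"): Hadamard on all coins (controls `y` and
offsets `Z`); the classical block `V` (with oracle gates; meant to compute
`|x (y Z) 0^m⟩ ↦ |x (y Z) (R y Z)⟩`, e.g. `R y Z = f(Z − A(y) mod Q)`); `S³` on the sine-test
controls; Hadamard on the CONTROLS only. (Kitaev 1995, §3, the measuring circuit of Lemma 10,
around a block reading a table through oracle gates as in Bernstein–Vazirani 1997, §8.3.)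
[cite: Kitaev1995, §3 (Remark 8, Lemma 10)] -/
def sandwich (V : QCircuit cliffordT (n + ((k₁ + k₂) + m))) (σ : Fin k₁ → Bool) :
    QCircuit cliffordT (n + ((k₁ + k₂) + m)) :=
  ⟨hadamardLayer n (k₁ + k₂) m ++ V.gates ++ phaseLayer n (k₁ + k₂) m (extσ σ) ++
    (yWires n k₁ k₂ m).map hOn⟩

/-- **The final Hadamard layer on the control wires**:
`H_controls |x (y Z) ρ⟩ = 2^{-k₁/2} ∑_γ (-1)^{y·γ} |x (γ Z) ρ⟩`.
[cite: NielsenChuang2010, §1.4.4] -/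
theorem hLayerY_mulVec_tri (x : QReg n) (y : QReg k₁) (Z : QReg k₂) (ρ : QReg m) :
    (⟨(yWires n k₁ k₂ m).map hOn⟩ : QCircuit cliffordT (n + ((k₁ + k₂) + m))).toMatrix 0 *ᵥ
        basisState (tri x (Fin.append y Z) ρ) =
      invSqrt2 ^ k₁ • ∑ γ : QReg k₁, ySign y γ • basisState (tri x (Fin.append γ Z) ρ) := by
  rw [hadamards_mulVec_basisState_signed _ yWires_nodup]
  ext z
  simp only [Pi.smul_apply, Finset.sum_apply, smul_eq_mul, basisState_apply, length_yWires,
    mul_ite, mul_one, mul_zero]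
  by_cases hP : ∀ i, i ∉ yWires n k₁ k₂ m → z i = tri x (Fin.append y Z) ρ i
  · rw [if_pos hP, Finset.sum_eq_single (fun j => z (yWire n k₁ k₂ m j))]
    · rw [if_pos ((eq_tri_append_iff x y Z ρ z _).2 ⟨hP, rfl⟩), hSign_yWires]
    · intro γ _ hγ
      exact if_neg fun h => hγ ((eq_tri_append_iff x y Z ρ z γ).1 h).2.symm
    · intro h; exact absurd (Finset.mem_univ _) h
  · rw [if_neg hP, Finset.sum_eq_zero fun γ _ => if_neg fun h =>
      hP ((eq_tri_append_iff x y Z ρ z γ).1 h).1, mul_zero]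

variable (A : Language Bool) (V : QCircuit cliffordT (n + ((k₁ + k₂) + m))) (σ : Fin k₁ → Bool)
  (x : QReg n) (R : QReg k₁ → QReg k₂ → QReg m)

/-- **The output state of the sandwich circuit** on `|x⟩|0…0⟩` relative to `A`, for a block
acting as `|x (y Z) 0^m⟩ ↦ |x (y Z) (R y Z)⟩` relative to `A`:
`2^{-(k₁+k₂)/2} 2^{-k₁/2} ∑_{y, Z, γ} (-i)^{#σ∧y} (-1)^{y·γ} |x (γ Z) (R y Z)⟩`.
[cite: Kitaev1995, §3 (Remark 8, Lemma 8)] -/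
theorem sandwich_runOn
    (hV : ∀ (y : QReg k₁) (Z : QReg k₂), V.toMatrix A *ᵥ basisState (coinInput x (Fin.append y Z)) =
      basisState (tri x (Fin.append y Z) (R y Z))) :
    (sandwich V σ).runOn A (basisState (padInput x ((k₁ + k₂) + m))) =
      (invSqrt2 ^ (k₁ + k₂) * invSqrt2 ^ k₁) •
        ∑ y : QReg k₁, ∑ Z : QReg k₂, ∑ γ : QReg k₁,
          (sPhase σ y * ySign y γ) • basisState (tri x (Fin.append γ Z) (R y Z)) := by
  have hsplit : sandwich V σ =
      ((((⟨hadamardLayer n (k₁ + k₂) m⟩ : QCircuit cliffordT _).append V).append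
        ⟨phaseLayer n (k₁ + k₂) m (extσ σ)⟩).append ⟨(yWires n k₁ k₂ m).map hOn⟩) := by
    simp [sandwich, QCircuit.append]
  -- the coin layer, reindexed by (controls, offsets)
  have hH : (⟨hadamardLayer n (k₁ + k₂) m⟩ : QCircuit cliffordT _).toMatrix A *ᵥ
      basisState (padInput x ((k₁ + k₂) + m)) =
      invSqrt2 ^ (k₁ + k₂) • ∑ y : QReg k₁, ∑ Z : QReg k₂,
        basisState (coinInput x (Fin.append y Z)) := by
    rw [hadamardLayer_toMatrix, hadamardLayer_mulVec_padInput]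
    congr 1
    rw [← Fintype.sum_prod_type', ← (appendEquiv k₁ k₂).sum_comp]
    rfl
  rw [QCircuit.runOn, hsplit, QCircuit.toMatrix_append, QCircuit.toMatrix_append,
    QCircuit.toMatrix_append, ← Matrix.mulVec_mulVec, ← Matrix.mulVec_mulVec,
    ← Matrix.mulVec_mulVec, hH, Matrix.mulVec_smul, Matrix.mulVec_sum]
  simp_rw [Matrix.mulVec_sum, hV]
  rw [Matrix.mulVec_smul, Matrix.mulVec_sum]
  simp_rw [Matrix.mulVec_sum, toMatrix_phaseLayer, phaseLayer_mulVec_tri, sPhase_extσ]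
  rw [Matrix.mulVec_smul, Matrix.mulVec_sum]
  simp_rw [Matrix.mulVec_sum, Matrix.mulVec_smul, toMatrix_hLayer, hLayerY_mulVec_tri, smul_smul,
    Finset.smul_sum, smul_smul]
  refine Finset.sum_congr rfl fun y _ => Finset.sum_congr rfl fun Z _ =>
    Finset.sum_congr rfl fun γ _ => ?_
  congr 1
  ring

/-- **The output amplitudes of the sandwich circuit** on the labels `x (γ Z) ρ`:
`ψ(x (γ Z) ρ) = 2^{-(k₁+k₂)/2} 2^{-k₁/2} ∑_{y : R y Z = ρ} (-i)^{#σ∧y} (-1)^{y·γ}`.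
[cite: Kitaev1995, §3 (Remark 8, Lemma 8)] -/
theorem sandwich_runOn_tri
    (hV : ∀ (y : QReg k₁) (Z : QReg k₂), V.toMatrix A *ᵥ basisState (coinInput x (Fin.append y Z)) =
      basisState (tri x (Fin.append y Z) (R y Z)))
    (γ : QReg k₁) (Z : QReg k₂) (ρ : QReg m) :
    (sandwich V σ).runOn A (basisState (padInput x ((k₁ + k₂) + m))) (tri x (Fin.append γ Z) ρ) =
      (invSqrt2 ^ (k₁ + k₂) * invSqrt2 ^ k₁) *
        ∑ y ∈ univ.filter (fun y => R y Z = ρ), sPhase σ y * ySign y γ := by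
  classical
  rw [sandwich_runOn A V σ x R hV]
  simp only [Pi.smul_apply, Finset.sum_apply, smul_eq_mul, basisState_apply, tri_eq_tri_iff,
    append_eq_append_iff, true_and, mul_ite, mul_one, mul_zero]
  congr 1
  rw [Finset.sum_filter]
  refine Finset.sum_congr rfl fun y _ => ?_
  rw [Finset.sum_eq_single Z]
  · rw [Finset.sum_eq_single γ]
    · by_cases h : R y Z = ρ
      · rw [if_pos ⟨⟨rfl, rfl⟩, h.symm⟩, if_pos h]
      · rw [if_neg (fun h' => h h'.2.symm), if_neg h]
    · intro γ' _ hγ'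
      exact if_neg fun h' => hγ' h'.1.1.symm
    · intro h; exact absurd (Finset.mem_univ _) h
  · intro Z' _ hZ'
    exact Finset.sum_eq_zero fun γ' _ => if_neg fun h' => hZ' h'.1.2.symm
  · intro h; exact absurd (Finset.mem_univ _) h

/-- Off the labels `x c ρ` (input wires not reading `x`) the output amplitude vanishes. [folklore] -/
theorem sandwich_runOn_of_ne
    (hV : ∀ (y : QReg k₁) (Z : QReg k₂), V.toMatrix A *ᵥ basisState (coinInput x (Fin.append y Z)) =
      basisState (tri x (Fin.append y Z) (R y Z)))
    (x' : QReg n) (hx : x' ≠ x) (c : QReg (k₁ + k₂)) (ρ : QReg m) :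
    (sandwich V σ).runOn A (basisState (padInput x ((k₁ + k₂) + m))) (tri x' c ρ) = 0 := by
  classical
  rw [sandwich_runOn A V σ x R hV]
  simp only [Pi.smul_apply, Finset.sum_apply, smul_eq_mul, basisState_apply, tri_eq_tri_iff]
  rw [Finset.sum_eq_zero fun y _ => Finset.sum_eq_zero fun Z _ => Finset.sum_eq_zero fun γ _ => by
    rw [if_neg (fun h => hx h.1), mul_zero], mul_zero]

/-- The register `x (y Z) ρ` as a 4-tuple. [folklore] -/
def quadEquiv (n k₁ k₂ m : ℕ) : QReg n × QReg k₁ × QReg k₂ × QReg m ≃ QReg (n + ((k₁ + k₂) + m)) :=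
  ((Equiv.refl (QReg n)).prodCongr ((Equiv.prodAssoc _ _ _).symm.trans
    ((appendEquiv k₁ k₂).prodCongr (Equiv.refl (QReg m))))).trans (triEquiv n (k₁ + k₂) m)

/-- `quadEquiv` is `tri x (y Z) ρ`. [folklore] -/
theorem quadEquiv_apply (p : QReg n × QReg k₁ × QReg k₂ × QReg m) :
    quadEquiv n k₁ k₂ m p = tri p.1 (Fin.append p.2.1 p.2.2.1) p.2.2.2 := rfl

/-- **Probability of a control event.** The Born probability that the control wires of the
output read a string in `E` is `∑_{γ ∈ E} ∑_Z ∑_ρ |ψ(x (γ Z) ρ)|²`. [folklore] -/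
theorem sandwich_prob_yEvent
    (hV : ∀ (y : QReg k₁) (Z : QReg k₂), V.toMatrix A *ᵥ basisState (coinInput x (Fin.append y Z)) =
      basisState (tri x (Fin.append y Z) (R y Z)))
    (E : Finset (QReg k₁)) :
    ∑ z ∈ univ.filter (fun z : QReg (n + ((k₁ + k₂) + m)) => (fun j => z (yWire n k₁ k₂ m j)) ∈ E),
        ‖(sandwich V σ).runOn A (basisState (padInput x ((k₁ + k₂) + m))) z‖ ^ 2 =
      ∑ γ ∈ E, ∑ Z : QReg k₂, ∑ ρ : QReg m,
        ‖(sandwich V σ).runOn A (basisState (padInput x ((k₁ + k₂) + m)))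
          (tri x (Fin.append γ Z) ρ)‖ ^ 2 := by
  classical
  set ψ := (sandwich V σ).runOn A (basisState (padInput x ((k₁ + k₂) + m))) with hψ
  rw [Finset.sum_filter, ← Fintype.sum_equiv (quadEquiv n k₁ k₂ m)
    (fun p => if (fun j => (quadEquiv n k₁ k₂ m p) (yWire n k₁ k₂ m j)) ∈ E then
      ‖ψ (quadEquiv n k₁ k₂ m p)‖ ^ 2 else 0) _ (fun p => rfl)]
  rw [Fintype.sum_prod_type, Fintype.sum_eq_single x]
  · rw [Fintype.sum_prod_type]
    simp only [quadEquiv_apply, tri_yWire]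
    have h2 : ∀ γ : QReg k₁, ((fun j => γ j) ∈ E) = (γ ∈ E) := fun γ => rfl
    simp only [h2, Fintype.sum_prod_type, Finset.sum_ite_irrel, Finset.sum_const_zero]
    rw [← Finset.sum_filter, Finset.filter_mem_eq_inter, Finset.univ_inter]
  · intro x' hx'
    rw [Fintype.sum_prod_type]
    refine Finset.sum_eq_zero fun γ _ => ?_
    rw [Fintype.sum_prod_type]
    refine Finset.sum_eq_zero fun Z _ => Finset.sum_eq_zero fun ρ _ => ?_
    rw [quadEquiv_apply, hψ, sandwich_runOn_of_ne A V σ x R hV x' hx', norm_zero]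
    simp

/-- The squared normalisation constant: `|2^{-(k₁+k₂)/2} 2^{-k₁/2}|² = 2^{-(k₁+k₂)} 2^{-k₁}`. [folklore] -/
theorem norm_sq_const (k₁ k₂ : ℕ) :
    ‖invSqrt2 ^ (k₁ + k₂) * invSqrt2 ^ k₁‖ ^ 2 = (1 / 2 : ℝ) ^ (k₁ + k₂) * (1 / 2 : ℝ) ^ k₁ := by
  rw [norm_mul, mul_pow, norm_invSqrt2_pow_sq, norm_invSqrt2_pow_sq]

/-- **The control read-out law of the sandwich circuit, raw form**: the Born probability that
the control read-out lies in `E` is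
`2^{-(k₁+k₂)} 2^{-k₁} ∑_{γ ∈ E} ∑_Z ∑_ρ |∑_{y : R y Z = ρ} (-i)^{#σ∧y} (-1)^{y·γ}|²`
(the left-hand side of `PeriodFinding.parseval_shift`). [cite: Kitaev1995, §3 (Lemma 8) and §4] -/
theorem sandwich_prob_yEvent_eq
    (hV : ∀ (y : QReg k₁) (Z : QReg k₂), V.toMatrix A *ᵥ basisState (coinInput x (Fin.append y Z)) =
      basisState (tri x (Fin.append y Z) (R y Z)))
    (E : Finset (QReg k₁)) :
    ∑ z ∈ univ.filter (fun z : QReg (n + ((k₁ + k₂) + m)) => (fun j => z (yWire n k₁ k₂ m j)) ∈ E),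
        ‖(sandwich V σ).runOn A (basisState (padInput x ((k₁ + k₂) + m))) z‖ ^ 2 =
      ((1 / 2 : ℝ) ^ (k₁ + k₂) * (1 / 2 : ℝ) ^ k₁) * ∑ γ ∈ E, ∑ Z : QReg k₂, ∑ ρ : QReg m,
        ‖∑ y ∈ univ.filter (fun y => R y Z = ρ), sPhase σ y * ySign y γ‖ ^ 2 := by
  classical
  rw [sandwich_prob_yEvent A V σ x R hV E, Finset.mul_sum]
  refine Finset.sum_congr rfl fun γ _ => ?_
  rw [Finset.mul_sum]
  refine Finset.sum_congr rfl fun Z _ => ?_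
  rw [Finset.mul_sum]
  refine Finset.sum_congr rfl fun ρ _ => ?_
  rw [sandwich_runOn_tri A V σ x R hV, norm_mul, mul_pow, norm_sq_const]

end sandwich

end PeriodFinding

end Literature.Computability.Cryptography

end
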